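import Literature.NumberTheory.Automorphic.QuaternionAlgebraAdelicMeasureProofs
import Literature.NumberTheory.Automorphic.QuaternionAlgebraAdelicMatrixProofs
import Literature.NumberTheory.Automorphic.QuaternionAlgebraClassification
import HarnessLib

/-!
# The automorphic measure of a quaternion algebra: reduction of the split case to `GL₂`
(`AdelicGroupData.exists_isAutomorphicMeasure_units` ⟸ `AdelicGroupData.exists_isAutomorphicMeasure_gl 2 K`)

Sibling proof file (theorems only, no `sorry`, no named fact) of
`Literature.NumberTheory.Automorphic.QuaternionAlgebraAdelic`, on top of
`QuaternionAlgebraAdelicMeasureProofs` (the division case). The named fact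
`AdelicGroupData.exists_isAutomorphicMeasure_units K D` — an automorphic measure on
`(D ⊗ 𝔸_K)ˣ ⧸ (ℝ_{>0} · Dˣ)` for *every* quaternion algebra `D/K`, Vignéras, LNM 800, Ch. III §2
Thm. 2.3 (`τ(X₁) = vol(X_{A,1}/X_K^×) = 1` for `X = H` or `M(2,K)`) — has two cases by
Wedderburn (`IsQuaternionAlgebra.division_or_split` of `QuaternionAlgebraClassification`, Vignéras
I §2 Cor. 2.4): `D` is a division
algebra (done in `QuaternionAlgebraAdelicMeasureProofs`), or `D ≃ M₂(K)`, where the statement *is*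
the finiteness of the volume of `GL₂(𝔸_K) ⧸ ℝ_{>0} GL₂(K)` (Vignéras loc. cit.: "Si `X = M(2,K)`,
on doit faire un calcul direct"; Borel–Harish-Chandra), vendored in `AdelicGroupData` as the named
fact `AdelicGroupData.exists_isAutomorphicMeasure_gl 2 K`. This file PROVES the reduction:

* `AdelicGroupData.exists_isAutomorphicMeasure_of_mulEquiv` — automorphic measures transport
  along a bicontinuous group isomorphism `G(𝔸_K) ≃ G'(𝔸_K)` of adelic group data mapping
  `A_G · G(K)` onto `A_{G'} · G'(K)` (it induces an equivariant homeomorphism of the automorphic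
  quotients);
* `exists_mulEquiv_generalLinearGroup_of_algEquiv` — a `K`-algebra isomorphism `D ≃ M_n(K)`
  induces a bicontinuous isomorphism `(D ⊗ 𝔸_K)ˣ ≃ GL_n(𝔸_K)` (base change
  `𝔸_K ⊗_K M_n(K) ≃ₐ[𝔸_K] M_n(𝔸_K)`, Mathlib `matrixEquivTensor`; both sides carry the
  `𝔸_K`-module topology) mapping `ℝ_{>0} · Dˣ` onto `ℝ_{>0} · GL_n(K)`;
* `AdelicGroupData.exists_isAutomorphicMeasure_units_of_gl` —
  **`exists_isAutomorphicMeasure_gl 2 K → exists_isAutomorphicMeasure_units K D`**, and conversely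
  `AdelicGroupData.exists_isAutomorphicMeasure_gl_two_of_units` —
  `exists_isAutomorphicMeasure_units K (M₂(K)) → exists_isAutomorphicMeasure_gl 2 K`: for the split
  algebra the two named facts are *equivalent*, so the discharge of
  `exists_isAutomorphicMeasure_units` is exactly as hard as Borel–Harish-Chandra for `GL₂`.

## References

* M.-F. Vignéras, *Arithmétique des algèbres de quaternions*, LNM 800 (1980), Ch. I §2 (Cor. 2.4:
  Wedderburn), Ch. III §2 Thm. 2.3 [VignerasLNM800].
* A. Borel, *Some finiteness properties of adele groups over number fields*, Publ. Math. IHÉS 16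
  (1963), §5 [Borel1963].
-/

noncomputable section

open NumberField IsDedekindDomain MeasureTheory Measure Topology
open scoped NNReal ENNReal TensorProduct MatrixGroups

namespace Literature.NumberTheory.Automorphic

universe u v

/-! ### Transport of automorphic measures along isomorphisms of adelic group data -/

namespace AdelicGroupData

variable {K : Type} [Field K] [NumberField K]

/-- **Automorphic measures transport along isomorphisms of adelic group data.** If
`φ : G(𝔸_K) ≃ G'(𝔸_K)` is a bicontinuous group isomorphism between the adelic groups of two data
`𝒢`, `𝒢'` with `φ(A_G · G(K)) = A_{G'} · G'(K)`, then `φ` induces a homeomorphism of automorphic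
quotients `G(𝔸_K) ⧸ A_G G(K) ≃ₜ G'(𝔸_K) ⧸ A_{G'} G'(K)` intertwining the actions of `g` and
`φ(g)`, along which an automorphic measure of `𝒢'` pulls back to an automorphic measure of `𝒢`
(finiteness, positivity on opens, inner regularity and invariance are preserved). [folklore] -/
theorem exists_isAutomorphicMeasure_of_mulEquiv (𝒢 : AdelicGroupData.{u} K)
    (𝒢' : AdelicGroupData.{v} K) (φ : 𝒢.Adelic ≃* 𝒢'.Adelic) (hφ : Continuous φ)
    (hφ' : Continuous φ.symm)
    (hH : 𝒢.quotientSubgroup.map φ.toMonoidHom = 𝒢'.quotientSubgroup)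
    (h : ∃ μ' : Measure 𝒢'.automorphicQuotient, 𝒢'.IsAutomorphicMeasure μ') :
    ∃ μ : Measure 𝒢.automorphicQuotient, 𝒢.IsAutomorphicMeasure μ := by
  obtain ⟨μ', hμ'⟩ := h
  have hmem : ∀ g, g ∈ 𝒢.quotientSubgroup ↔ φ g ∈ 𝒢'.quotientSubgroup := by
    intro g
    rw [← hH, Subgroup.mem_map]
    constructor
    · exact fun hg => ⟨g, hg, rfl⟩
    · rintro ⟨x, hx, hxg⟩
      have : x = g := φ.injective hxg
      rwa [← this]
  -- the homeomorphism of automorphic quotients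
  let f : 𝒢.automorphicQuotient → 𝒢'.automorphicQuotient :=
    Quotient.map' (fun g => φ g) fun a b hab => by
      rw [QuotientGroup.leftRel_apply] at hab ⊢
      rw [← map_inv, ← map_mul]
      exact (hmem _).1 hab
  let b : 𝒢'.automorphicQuotient → 𝒢.automorphicQuotient :=
    Quotient.map' (fun g' => φ.symm g') fun a c hac => by
      rw [QuotientGroup.leftRel_apply] at hac ⊢
      rw [hmem, map_mul, map_inv, MulEquiv.apply_symm_apply, MulEquiv.apply_symm_apply]
      exact hac
  have hfb : ∀ q, f (b q) = q := by
    intro q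
    induction q using Quotient.inductionOn' with
    | h g =>
      change (QuotientGroup.mk (φ (φ.symm g)) : 𝒢'.Adelic ⧸ 𝒢'.quotientSubgroup) =
        QuotientGroup.mk g
      rw [MulEquiv.apply_symm_apply]
  have hbf : ∀ q, b (f q) = q := by
    intro q
    induction q using Quotient.inductionOn' with
    | h g =>
      change (QuotientGroup.mk (φ.symm (φ g)) : 𝒢.Adelic ⧸ 𝒢.quotientSubgroup) = QuotientGroup.mk g
      rw [MulEquiv.symm_apply_apply]
  let e : 𝒢.automorphicQuotient ≃ₜ 𝒢'.automorphicQuotient :=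
    { toFun := f
      invFun := b
      left_inv := hbf
      right_inv := hfb
      continuous_toFun := hφ.quotient_map' _
      continuous_invFun := hφ'.quotient_map' _ }
  have he : ∀ (g : 𝒢.Adelic) (q : 𝒢.automorphicQuotient), e (g • q) = φ g • e q := by
    intro g q
    induction q using Quotient.inductionOn' with
    | h x =>
      change (QuotientGroup.mk (φ (g * x)) : 𝒢'.Adelic ⧸ 𝒢'.quotientSubgroup) =
        QuotientGroup.mk (φ g * φ x)
      rw [map_mul]
  have he' : ∀ (g : 𝒢.Adelic) (q : 𝒢'.automorphicQuotient), e.symm (φ g • q) = g • e.symm q := by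
    intro g q
    apply e.injective
    rw [he, e.apply_symm_apply, e.apply_symm_apply]
  -- the transported measure
  haveI := hμ'
  have hem : Measurable e.symm := e.symm.continuous.measurable
  set μ : Measure 𝒢.automorphicQuotient := μ'.map e.symm with hμ
  have hμs : ∀ s : Set 𝒢.automorphicQuotient, MeasurableSet s → μ s = μ' (e.symm ⁻¹' s) :=
    fun s hs => by rw [hμ, Measure.map_apply hem hs]
  haveI : IsFiniteMeasure μ := inferInstance
  haveI : μ.IsOpenPosMeasure := e.symm.continuous.isOpenPosMeasure_map e.symm.surjective
  haveI : μ.InnerRegularCompactLTTop :=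
    Measure.InnerRegularCompactLTTop.map_of_continuous e.symm.continuous
  haveI : SMulInvariantMeasure 𝒢.Adelic 𝒢.automorphicQuotient μ := by
    refine ⟨fun g s hs => ?_⟩
    have hgs : MeasurableSet ((fun q : 𝒢.automorphicQuotient => g • q) ⁻¹' s) :=
      measurable_const_smul g hs
    rw [hμs s hs, hμs _ hgs]
    have hset : e.symm ⁻¹' ((fun q : 𝒢.automorphicQuotient => g • q) ⁻¹' s) =
        (fun q : 𝒢'.automorphicQuotient => φ g • q) ⁻¹' (e.symm ⁻¹' s) := by
      ext q
      simp only [Set.mem_preimage, he']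
    rw [hset]
    exact SMulInvariantMeasure.measure_preimage_smul _ (hem hs)
  exact ⟨μ, {}⟩

end AdelicGroupData

/-! ### Base change of a matrix algebra along `D ≃ M_n(K)`: `(D ⊗ 𝔸_K)ˣ ≃ GL_n(𝔸_K)` -/

section Split

variable (K : Type) [Field K] [NumberField K] (D : Type u) [Ring D] [Algebra K D]
  [Module.Finite K D] (n : ℕ)

/-- **`(D ⊗ 𝔸_K)ˣ ≃ GL_n(𝔸_K)` for `D ≃ M_n(K)`.** A `K`-algebra isomorphism `e : D ≃ M_n(K)`
induces a bicontinuous group isomorphism `φ : (𝔸_K ⊗_K D)ˣ ≃ GL_n(𝔸_K)` — through the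
`𝔸_K`-algebra isomorphism `𝔸_K ⊗_K D ≃ 𝔸_K ⊗_K M_n(K) ≃ M_n(𝔸_K)` (Mathlib
`Algebra.TensorProduct.congr`, `matrixEquivTensor`; `r ⊗ M ↦ r · M`), a homeomorphism since both
sides carry the `𝔸_K`-module topology — which maps the image `1 ⊗ Dˣ` of `Dˣ` onto `GL_n(K)`
(`1 ⊗ d ↦ e(d)`) and the central positive reals `z(t) ⊗ 1` onto the positive real scalar matrices
`z(t) · 1`, hence `ℝ_{>0} · Dˣ` onto `ℝ_{>0} · GL_n(K)`:
`φ((units K D).quotientSubgroup) = (gl n K).quotientSubgroup`. (Vignéras I §2: `H_F = F ⊗ H`,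
`M(2,K)_F = M(2,F)`.) [folklore] -/
theorem exists_mulEquiv_generalLinearGroup_of_algEquiv (e : D ≃ₐ[K] Matrix (Fin n) (Fin n) K) :
    ∃ φ : adelicUnits K D ≃* GL (Fin n) (AdeleRing (𝓞 K) K), Continuous φ ∧ Continuous φ.symm ∧
      (AdelicGroupData.units K D).quotientSubgroup.map φ.toMonoidHom =
        (AdelicGroupData.gl n K).quotientSubgroup := by
  set A := AdeleRing (𝓞 K) K with hA
  -- `Ψ : A ⊗[K] M_n(K) ≃ₐ[A] M_n(A)`, `a ⊗ M ↦ a • M`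
  let Ψ : A ⊗[K] Matrix (Fin n) (Fin n) K ≃ₐ[A] Matrix (Fin n) (Fin n) A :=
    AlgEquiv.ofRingEquiv (f := (matrixEquivTensor (Fin n) K A).symm.toRingEquiv) fun r ↦ by
      change (matrixEquivTensor (Fin n) K A).symm (algebraMap A (A ⊗[K] Matrix (Fin n) (Fin n) K) r) = _
      rw [Algebra.TensorProduct.algebraMap_apply, Algebra.algebraMap_self, RingHom.id_apply,
        matrixEquivTensor_apply_symm, Matrix.map_one _ (map_zero _) (map_one _),
        Algebra.algebraMap_eq_smul_one]
  have hΨ : ∀ (a : A) (M : Matrix (Fin n) (Fin n) K),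
      Ψ (a ⊗ₜ[K] M) = a • M.map (algebraMap K A) := fun a M => rfl
  -- `Φ : A ⊗[K] D ≃ₐ[A] M_n(A)`
  let Φ : ScalarExtension K A D ≃ₐ[A] Matrix (Fin n) (Fin n) A :=
    ((ScalarExtension.ofTensor K A D).symm.trans
      (Algebra.TensorProduct.congr (AlgEquiv.refl : A ≃ₐ[A] A) e)).trans Ψ
  have hΦincl : ∀ d : D, Φ (ScalarExtension.incl K A D d) = (e d).map (algebraMap K A) := by
    intro d
    change Ψ (Algebra.TensorProduct.congr (AlgEquiv.refl : A ≃ₐ[A] A) e ((1 : A) ⊗ₜ[K] d)) = _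
    rw [Algebra.TensorProduct.congr_apply, Algebra.TensorProduct.map_tmul]
    change Ψ ((1 : A) ⊗ₜ[K] e d) = _
    rw [hΨ, one_smul]
  have hΦalg : ∀ a : A, Φ (algebraMap A (ScalarExtension K A D) a) =
      algebraMap A (Matrix (Fin n) (Fin n) A) a := fun a => Φ.commutes a
  -- continuity: both sides carry the `A`-module topology
  haveI : IsModuleTopology A (Matrix (Fin n) (Fin n) A) :=
    inferInstanceAs (IsModuleTopology A (Fin n → Fin n → A))
  have hΦc : Continuous Φ := IsModuleTopology.continuous_of_linearMap Φ.toLinearEquiv.toLinearMap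
  have hΦc' : Continuous Φ.symm :=
    IsModuleTopology.continuous_of_linearMap Φ.symm.toLinearEquiv.toLinearMap
  -- the isomorphism of unit groups
  let φ : adelicUnits K D ≃* GL (Fin n) A := Units.mapEquiv Φ.toMulEquiv
  have hφval : ∀ u : adelicUnits K D, ((φ u : GL (Fin n) A) : Matrix (Fin n) (Fin n) A) =
      Φ (u : ScalarExtension K A D) := fun u => rfl
  have hφc : Continuous φ := Continuous.units_map Φ.toMulEquiv.toMonoidHom hΦc
  have hφc' : Continuous φ.symm := Continuous.units_map Φ.symm.toMulEquiv.toMonoidHom hΦc'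
  refine ⟨φ, hφc, hφc', ?_⟩
  -- images of the two pieces of `ℝ_{>0} · Dˣ`
  have h1 : φ.toMonoidHom.comp (posRealCentral K D) = posRealScalar n K := by
    refine MonoidHom.ext fun t => Units.ext ?_
    change ((φ (posRealCentral K D t) : GL (Fin n) A) : Matrix (Fin n) (Fin n) A) =
      ((posRealScalar n K t : GL (Fin n) A) : Matrix (Fin n) (Fin n) A)
    rw [hφval]
    change Φ (algebraMap A (ScalarExtension K A D) (posRealIdele K t : Aˣ)) =
      Matrix.scalar (Fin n) ((posRealIdele K t : Aˣ) : A)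
    rw [hΦalg]
    rfl
  have h2 : φ.toMonoidHom.comp (inclAdelic K D) =
      (Matrix.GeneralLinearGroup.map (algebraMap K A)).comp
        (Units.mapEquiv e.toMulEquiv).toMonoidHom := by
    refine MonoidHom.ext fun d => Units.ext ?_
    change ((φ (inclAdelic K D d) : GL (Fin n) A) : Matrix (Fin n) (Fin n) A) =
      (algebraMap K A).mapMatrix (e d)
    rw [hφval, coe_inclAdelic, hΦincl, RingHom.mapMatrix_apply]
  have hsurj : (Units.mapEquiv e.toMulEquiv).toMonoidHom.range = ⊤ :=
    MonoidHom.range_eq_top.2 (Units.mapEquiv e.toMulEquiv).surjective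
  change (((posRealCentral K D).range ⊔ (inclAdelic K D).range : Subgroup (adelicUnits K D))).map
      φ.toMonoidHom = ((posRealScalar n K).range ⊔
        (Matrix.GeneralLinearGroup.map (algebraMap K A)).range : Subgroup (GL (Fin n) A))
  rw [Subgroup.map_sup, MonoidHom.map_range, MonoidHom.map_range, h1, h2, MonoidHom.range_comp,
    hsurj, ← MonoidHom.range_eq_map]

end Split

/-! ### The reduction to `GL₂` -/

section Reduction

variable (K : Type) [Field K] [NumberField K] (D : Type u) [Ring D] [Algebra K D]

/-- **Reduction of `exists_isAutomorphicMeasure_units` to `GL₂`.** Granted an automorphic measure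
on `GL₂(𝔸_K) ⧸ ℝ_{>0} GL₂(K)` (the named fact `AdelicGroupData.exists_isAutomorphicMeasure_gl 2 K`,
Borel–Harish-Chandra; Vignéras III §2 Thm. 2.3 for `X = M(2,K)`), every quaternion algebra `D`
over the number field `K` carries an automorphic measure on `(D ⊗ 𝔸_K)ˣ ⧸ (ℝ_{>0} · Dˣ)`: by the
Wedderburn dichotomy (`IsQuaternionAlgebra.division_or_split`, Vignéras I §2 Cor. 2.4), either
`D` is a division algebra
(`AdelicGroupData.exists_isAutomorphicMeasure_units_of_isUnit`, Fujisaki) or `D ≃ M₂(K)` and the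
datum of `D^×` is isomorphic to that of `GL₂` (`exists_mulEquiv_generalLinearGroup_of_algEquiv`,
`AdelicGroupData.exists_isAutomorphicMeasure_of_mulEquiv`).
[cite: VignerasLNM800, Ch. III §2 Thm. 2.3; Borel1963 §5] -/
theorem AdelicGroupData.exists_isAutomorphicMeasure_units_of_gl
    (hgl : AdelicGroupData.exists_isAutomorphicMeasure_gl 2 K) :
    AdelicGroupData.exists_isAutomorphicMeasure_units K D := by
  intro hQ
  rcases IsQuaternionAlgebra.division_or_split K D with hdiv | hne
  · exact AdelicGroupData.exists_isAutomorphicMeasure_units_of_isUnit K D hdiv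
  · obtain ⟨φ, hφ, hφ', hH⟩ := exists_mulEquiv_generalLinearGroup_of_algEquiv K D 2 hne.some
    exact AdelicGroupData.exists_isAutomorphicMeasure_of_mulEquiv (AdelicGroupData.units K D)
      (AdelicGroupData.gl 2 K) φ hφ hφ' hH hgl

/-- **Conversely, the split case of `exists_isAutomorphicMeasure_units` is Borel–Harish-Chandra
for `GL₂`**: an automorphic measure on `(M₂(K) ⊗ 𝔸_K)ˣ ⧸ (ℝ_{>0} · GL₂(K))` (the named fact
`exists_isAutomorphicMeasure_units` for the split quaternion algebra `D = M₂(K)`,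
`isQuaternionAlgebra_matrix`) yields one on `GL₂(𝔸_K) ⧸ ℝ_{>0} GL₂(K)`
(`exists_isAutomorphicMeasure_gl 2 K`), by transport along the inverse of
`(M₂(K) ⊗ 𝔸_K)ˣ ≃ GL₂(𝔸_K)`. So for `D = M₂(K)` the two named facts are equivalent.
[cite: VignerasLNM800, Ch. III §2 Thm. 2.3] -/
theorem AdelicGroupData.exists_isAutomorphicMeasure_gl_two_of_units
    (h : AdelicGroupData.exists_isAutomorphicMeasure_units K (Matrix (Fin 2) (Fin 2) K)) :
    AdelicGroupData.exists_isAutomorphicMeasure_gl 2 K := by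
  haveI : IsQuaternionAlgebra K (Matrix (Fin 2) (Fin 2) K) := isQuaternionAlgebra_matrix K
  obtain ⟨φ, hφ, hφ', hH⟩ := exists_mulEquiv_generalLinearGroup_of_algEquiv K
    (Matrix (Fin 2) (Fin 2) K) 2 AlgEquiv.refl
  have hH' : (AdelicGroupData.gl 2 K).quotientSubgroup.map φ.symm.toMonoidHom =
      (AdelicGroupData.units K (Matrix (Fin 2) (Fin 2) K)).quotientSubgroup := by
    rw [← hH, Subgroup.map_map]
    have : φ.symm.toMonoidHom.comp φ.toMonoidHom = MonoidHom.id _ :=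
      MonoidHom.ext fun x => φ.symm_apply_apply x
    rw [this, Subgroup.map_id]
  exact AdelicGroupData.exists_isAutomorphicMeasure_of_mulEquiv (AdelicGroupData.gl 2 K)
    (AdelicGroupData.units K (Matrix (Fin 2) (Fin 2) K)) φ.symm hφ' hφ hH' h

end Reduction

end Literature.NumberTheory.Automorphic
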